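import Literature.Computability.AlgebraicComplexity.PowerSumNonvanishing
import Literature.Computability.AlgebraicComplexity.PlethysmStability
import Literature.RepresentationTheory.GeneralLinear.WreathHighestWeight
import Literature.NumberTheory.DiophantineGeometry.SymmetricGroupRepsFinrankSpechtProofs
import HarnessLib

/-!
# BIP 2019 §3–§4 AS PRINTED: the statements of Bürgisser–Ikenmeyer–Panova absent from the tree
# in their literal form (val-lit cell, DAG row BIP19-A; typed literature; §5/§7: `BIP19Lifting.lean`)

Source: P. Bürgisser, C. Ikenmeyer, G. Panova, *No occurrence obstructions in geometric complexity
theory*, J. Amer. Math. Soc. 32 (2019) 163–193 = arXiv:1604.06431v3 [key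
`BurgisserIkenmeyerPanovaJAMS2019`]. Numbering = the journal's = the e-print TeX section counters
(`[tex:1604.06431 main.tex Lnnn]` = line of `pub-gct/inputs/files/src/1604.06431/main.tex`); JAMS
page = arXiv PDF page + 162.

The tree already PROVES BIP's Thm. 1.4 verbatim with its printed range `n ≥ m^25`
(`Literature.Computability.Complexity.bip2019_no_occurrence_obstructions` + `_holds`), Thm. 2.1,
Lemma 2.2, Props. 2.3/2.4, Thm. 2.5, Cor. 2.6, Lemma 3.1 (coefficient form), Prop. 3.2, Prop. 3.3
(basis form), Lemma 4.3(1) (base case), Thm. 4.7 (word model), Cor. 4.8 (dual form, hyperdeterminant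
polynomial), Thm. 4.9, Lemmas 5.1–5.3, Thm. 5.4 (dual inner lifting `innerLift`), Props. 5.6(2),
5.8(2), 6.1, Thm. 6.2, Prop. 6.3, Claim 7.1 (abstract row-rigidity form) and Prop. 7.3 — see the
crosswalk `pub-gct-max/typed/AS-PRINTED-2.md §A` and the files cited below; NOTHING of that is
restated here. This file adds only the printed statements whose LITERAL form the tree lacks:

* `aeval_coeff_genericPowerSum_ne_zero` — **Prop. 3.2 in its printed "Zariski almost all" form**:
  the pull-back of a nonzero `F` along the generic power sum with `r ≥ deg F` terms is a NONZERO
  polynomial in the coefficients of the linear forms (so its non-vanishing set is a nonempty Zariski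
  open subset of `(V^*)^r`); proved from `exists_aeval_formCoeff_sum_linearFormPow_ne_zero`.
* `polytabloidSpan_eq_highestWeightSpace` — **Prop. 3.3 as printed**: `HWV_λ(⊗^D V)` IS the span
  of the `S_D`-orbit of `v_λ` (`v_λ = e_{T₀}`, the polytabloid of the row-reading tableau;
  `polytabloidSpan` = the `k[S_D]`-span of it); the tree had the basis form
  `highestWeightSpace_wordRep_eq_span_polytabloid` (span of the STANDARD polytabloids).
* `tabVector_eq_zero_of_blockIdx_eq` — **Lemma 4.3(1) for every tableau with content** `T_λ(π)`
  (the tree's `StdFilling.blockSymmetrizer_polytabloid_eq_zero` is the case `π = 1`);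
  `StdFilling.wordPerm_polytabloid_of_rowPreserving` — BIP (3.6) (switching columns of equal
  length fixes `π v_λ`); `tabVector_mul_eq_of_rowPreserving` — **Lemma 4.3(2)**.
* `wreathHW_one_eq_span_tabVector` — **Prop. 4.5 as printed**: `HWV_λ(Sym^d Sym^n V)` (the
  `S_d ≀ S_n`-invariant highest-weight vectors of weight `λ` of the word model,
  `Literature.RepresentationTheory.GeneralLinear.wreathHW k N 1 λ`) is SPANNED by the `v_T`, `T`
  ranging over the tableaux of shape `λ` with content `d × n` in which no letter appears twice in a
  column (Def. 4.4's passage to equivalence classes only removes duplicate generators, Lemma 4.3(2)).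

All statements of this file are PROVED (no new named fact). The §5/§7 statements absent from the
tree (Props. 5.6(1), 5.8(1) — the isomorphism halves — and Prop. 7.2) are in the companion
`BIP19Lifting.lean`. Deliberately NOT typed (objects absent from the tree, no downstream user;
recorded in the val-lit crosswalk): Def. 4.4 (the equivalence `≃` of tableaux) and the literal
`v_T`-form of Cor. 4.8 (tree: dual form `aeval_hyperdetPoly_scaled_powerSum` for the
hyperdeterminant polynomial).

Conventions: the word model `wordRep k N D` of `(k^N)^{⊗D}` (`TensorWordModel.lean`), position
permutations `wordPerm` (`(σ·c)(w) = c(w ∘ σ)`), blocks `blockIdx`/`blockPerms`/`blockSymmetrizer`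
and tableau vectors `tabVector k hN T₀ π = Σ_{D,m}(π · e_{T₀})` of `PlethysmStability.lean`; in
`tabVector k hN T₀ π` the content tableau `T_λ(π)` gives the cell `T₀ p` the letter
`blockIdx D m (π p)` (the number `π p` sits in the cell of `p`, and numbers are replaced by their
block). Typed literature; VP ≠ VNP is NOT proved and nothing here is progress on it.

## References

* [BurgisserIkenmeyerPanovaJAMS2019] P. Bürgisser, C. Ikenmeyer, G. Panova, J. AMS 32 (2019)
  163–193 = arXiv:1604.06431v3: Prop. 3.2 [tex L1038–1046], Prop. 3.3 [tex L1142–1145], (3.6)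
  [tex L1185–1190], Def. 4.2, Lemma 4.3 [tex L1275–1296], Def. 4.4, Prop. 4.5 [tex L1322–1343];
  held arXiv v1 text `paper:arxiv-1604.06431` (flat numbering): Cor. 7 p0006.txt:L146, Prop. 9
  p0007.txt:L100, (3.6) p0008.txt:L19, Lemma 12 p0009.txt:L94, Def. 13 p0009.txt:L129, Prop. 14
  p0009.txt:L145.
* W. Fulton, *Young Tableaux*, LMS Student Texts 35 (1997), §7.2 Exercise 3 (`σ · v_T = v_{σT}`).
-/

open MvPolynomial
open scoped BigOperators

namespace Literature.Computability.AlgebraicComplexity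

open Literature.NumberTheory.DiophantineGeometry

/-! ### Prop. 3.2 in the printed "Zariski almost all" form -/

section Prop32

variable {k : Type*} [Field k] [IsAlgClosed k] [CharZero k]

/-- **BIP Prop. 3.2, as printed ("Zariski almost all").** "Let `V` be a finite dimensional
`ℂ`-vector space and `d, n ≥ 1`. If `f ∈ Sym^d Sym^n V` is nonzero, then
`⟨f, (φ_1^n + ⋯ + φ_d^n)^d⟩ ≠ 0` for Zariski almost all `(φ_1, …, φ_d) ∈ (V^*)^d`. This means
that `f`, viewed as a homogeneous polynomial function of degree `d` on `Sym^n V^*`, does not vanish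
on almost all power sums `φ_1^n + ⋯ + φ_d^n` with `d` terms." [tex:1604.06431 L1038–1046; held arXiv v1 text `paper:arxiv-1604.06431` Corollary 7,
p0006.txt:L146–L149, stated there for `F ∈ Sym^d(Sym^n V)^*` and `(v_1, …, v_d) ∈ V^d`]. Here (`V = k^σ`, `k` algebraically closed of characteristic zero, `n ≥ 1`): for a nonzero
polynomial `F` of degree `≤ r` in the degree-`n` coefficients, the polynomial
`P(Y) = F(coefficients of ∑_{i<r} (∑_x Y_{(i,x)} X_x)^n)` in the `r·|σ|` indeterminate coefficients
`Y_{(i,x)}` of the linear forms is NONZERO — so `{φ' : P(φ') ≠ 0}`, which by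
`eval_aeval_coeff_genericPowerSum` is exactly the set of `(φ_1, …, φ_r)` with
`F(φ_1^n + ⋯ + φ_r^n) ≠ 0`, is a nonempty Zariski open (hence dense) subset of `(V^*)^r`. For
`f ∈ Sym^d Sym^n V` take `r = d = deg F`. Proof: the tree's existence form
`exists_aeval_formCoeff_sum_linearFormPow_ne_zero` gives one good `φ`, at which `P` does not
vanish. `-- DISCHARGEABLE` (proved here). [cite: BurgisserIkenmeyerPanovaJAMS2019, Prop. 3.2] -/
theorem aeval_coeff_genericPowerSum_ne_zero {σ : Type*} [Fintype σ] [DecidableEq σ] {n r : ℕ}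
    (hn : 0 < n) (F : MvPolynomial (DegIdx σ n) k) (hF : F ≠ 0) (hFr : F.totalDegree ≤ r) :
    aeval (fun e : DegIdx σ n => coeff e.1 (∑ i : Fin r,
      (∑ x, C (X (i, x)) * X x : MvPolynomial σ (MvPolynomial (Fin r × σ) k)) ^ n)) F ≠ 0 := by
  intro hzero
  obtain ⟨φ, hφ⟩ := exists_aeval_formCoeff_sum_linearFormPow_ne_zero hn F hF hFr
  apply hφ
  have h := eval_aeval_coeff_genericPowerSum r n F (fun ix => φ ix.1 ix.2)
  rw [hzero, map_zero] at h
  exact h.symm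

end Prop32

/-! ### Prop. 3.3 as printed: `HWV_λ(⊗^D V)` is the span of the `S_D`-orbit of `v_λ` -/

section Prop33

variable (k : Type*) [Field k] [CharZero k] {N d : ℕ}

/-- **BIP Prop. 3.3, as printed.** "Let `λ ⊢ D`. Then the vector space `HWV_λ(⊗^D V)` is spanned
by the `S_D`-orbit of `v_λ`." [tex:1604.06431 L1142–1145; held arXiv v1 text `paper:arxiv-1604.06431` Proposition 9,
p0007.txt:L100–L102]. Here `V = k^N`
(`ℓ(λ) ≤ N`, characteristic zero), `⊗^D V` is the word model `wordRep k N D`, `v_λ` is the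
polytabloid `e_{T₀}` of the row-reading standard tableau `T₀` of shape `λ` (a position permutation
of BIP's (3.3) `v_λ = v_{μ_1×1} ⊗ ⋯ ⊗ v_{μ_{λ_1}×1}`, the polytabloid of the column-standard
tableau — the two generate the same `k[S_D]`-module, Fulton §7.2 Ex. 3), and "the span of the
`S_D`-orbit" is `polytabloidSpan k λ hN`, the image of `k[S_D] · e_{T₀}`
(`SymmetricGroupRepsFinrankSpechtProofs.lean`). Proof: `⊆` is
`polytabloidSpan_le_highestWeightSpace`; `⊇`: `HWV_λ` is spanned by the standard polytabloids
(`highestWeightSpace_wordRep_eq_span_polytabloid`, the tree's basis form of Prop. 3.3), each of which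
lies in the orbit span (`polytabloid_mem_polytabloidSpan`). `-- DISCHARGEABLE` (proved here).
[cite: BurgisserIkenmeyerPanovaJAMS2019, Prop. 3.3] -/
theorem polytabloidSpan_eq_highestWeightSpace (μ : Nat.Partition d)
    (hN : ∀ x ∈ μ.youngDiagram.cells, x.1 < N) :
    polytabloidSpan k μ hN = highestWeightSpace (wordRep k N d) (ydWeight N μ.youngDiagram) := by
  refine le_antisymm (polytabloidSpan_le_highestWeightSpace k μ hN) ?_
  rw [highestWeightSpace_wordRep_eq_span_polytabloid hN μ.card_cells_youngDiagram]
  refine Submodule.span_le.mpr ?_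
  rintro _ ⟨T, rfl⟩
  exact polytabloid_mem_polytabloidSpan k μ hN T

end Prop33

/-! ### Lemma 4.3 for every tableau with content, and (3.6) -/

section Lemma43

variable {k : Type*} [Field k] {N d : ℕ} {Y : YoungDiagram}

/-- **BIP (3.6): switching columns of equal length fixes `π v_λ`.** "Moreover, if `τ` is a
permutation that switches two columns of the same length in `π T_λ^std`, then `τ π v_λ = π v_λ`."
[tex:1604.06431 L1185–1190; held v1 text `paper:arxiv-1604.06431` p0008.txt:L19–L20]. In the word
model, for the polytabloid `e_T` of a standard filling `T` and a permutation `κ` of the entries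
which PRESERVES THE ROW of every entry and MAPS COLUMNS TO COLUMNS (two entries share a column iff
their images do — e.g. the row-wise exchange of two columns of the same length, or any product of
such): `κ · e_T = e_T`. Proof: `κ` fixes the row word `w_T` and normalises the column stabiliser
`C_T` with `sgn(κ σ κ⁻¹) = sgn σ`, so conjugation by `κ` permutes the summands of
`e_T = ∑_{σ ∈ C_T} sgn σ · e_{w_T ∘ σ⁻¹}`. `-- DISCHARGEABLE` (proved here).
[cite: BurgisserIkenmeyerPanovaJAMS2019, §3(b) (3.6)] -/
theorem _root_.Literature.NumberTheory.DiophantineGeometry.StdFilling.wordPerm_polytabloid_of_rowPreserving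
    (hN : ∀ x ∈ Y.cells, x.1 < N) (T : StdFilling d Y) {κ : Equiv.Perm (Fin d)}
    (hrow : ∀ p, (T.1 (κ p)).1 = (T.1 p).1)
    (hcol : ∀ p q, (T.1 (κ p)).2 = (T.1 (κ q)).2 ↔ (T.1 p).2 = (T.1 q).2) :
    wordPerm k κ (T.polytabloid k hN) = T.polytabloid k hN := by
  classical
  have e1 : ∀ x, κ⁻¹ (κ x) = x := fun x => κ.symm_apply_apply x
  have e2 : ∀ x, κ (κ⁻¹ x) = x := fun x => κ.apply_symm_apply x
  -- conjugation by `κ` and by `κ⁻¹` preserves the column stabiliser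
  have hconj : ∀ σ ∈ T.colStab, κ * σ * κ⁻¹ ∈ T.colStab := by
    intro σ hσ
    rw [StdFilling.mem_colStab] at hσ ⊢
    intro p
    have h := (hcol (σ (κ⁻¹ p)) (κ⁻¹ p)).mpr (hσ (κ⁻¹ p))
    rw [e2] at h
    rw [Equiv.Perm.mul_apply, Equiv.Perm.mul_apply]
    exact h
  have hconj' : ∀ σ ∈ T.colStab, κ⁻¹ * σ * κ ∈ T.colStab := by
    intro σ hσ
    rw [StdFilling.mem_colStab] at hσ ⊢
    intro p
    have h := hσ (κ p)
    rw [Equiv.Perm.mul_apply, Equiv.Perm.mul_apply, ← hcol, e2]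
    exact h
  -- `κ` fixes the row word
  have hroww : ∀ x, T.rowWord hN (κ x) = T.rowWord hN x := fun x => Fin.ext (by
    rw [StdFilling.rowWord_val, StdFilling.rowWord_val, hrow])
  funext w
  rw [wordPerm_apply, StdFilling.polytabloid_apply, StdFilling.polytabloid_apply]
  refine Finset.sum_bij' (fun σ _ => κ * σ * κ⁻¹) (fun σ _ => κ⁻¹ * σ * κ) ?_ ?_ ?_ ?_ ?_
  · exact fun σ hσ => hconj σ hσ
  · exact fun σ hσ => hconj' σ hσ
  · intro σ _; group
  · intro σ _; group
  · intro σ _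
    have hsgn : Equiv.Perm.sign (κ * σ * κ⁻¹) = Equiv.Perm.sign σ := by
      rw [Equiv.Perm.sign_mul, Equiv.Perm.sign_mul, Equiv.Perm.sign_inv,
        mul_comm (Equiv.Perm.sign κ), mul_assoc, Int.units_mul_self, mul_one]
    have hiff : w ∘ ⇑κ = T.rowWord hN ∘ ⇑σ⁻¹ ↔ w = T.rowWord hN ∘ ⇑(κ * σ * κ⁻¹)⁻¹ := by
      constructor
      · intro h
        funext p
        have hp : w (κ (κ⁻¹ p)) = T.rowWord hN (σ⁻¹ (κ⁻¹ p)) := congrFun h (κ⁻¹ p)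
        rw [e2] at hp
        rw [hp, Function.comp_apply, mul_inv_rev, mul_inv_rev, inv_inv, Equiv.Perm.mul_apply,
          Equiv.Perm.mul_apply, hroww]
      · intro h
        funext x
        rw [Function.comp_apply, Function.comp_apply, h, Function.comp_apply, mul_inv_rev,
          mul_inv_rev, inv_inv, Equiv.Perm.mul_apply, Equiv.Perm.mul_apply, e1, hroww]
    rw [hsgn]
    exact if_congr hiff rfl rfl

variable [CharZero k] {D m : ℕ}

/-- **BIP Lemma 4.3(1), for every tableau with content.** "Let `T` be a tableau of shape `λ`
with content `d × n`. If the same letter appears in a column of `T` more than once, then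
`v_T = 0`." [tex:1604.06431 L1286–1291; held arXiv v1 text `paper:arxiv-1604.06431` Lemma 12,
p0009.txt:L94–L97]. In the word model `v_T = tabVector k hN T₀ π` (unnormalised
`Σ_{d,n} π v_λ`, `PlethysmStability.lean`) for `T = T_λ(π)`, the tableau in which the cell `T₀ p`
of the standard filling `T₀` carries the letter `blockIdx D m (π p)` (the block of the number
`π p` written into that cell): if two distinct entries `p ≠ q` of one column of `T₀` have `π p`,
`π q` in the same block — the same letter twice in that column of `T` — then `v_T = 0`. The
tree's `StdFilling.blockSymmetrizer_polytabloid_eq_zero` is the case `π = 1`. BIP's proof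
verbatim: the transposition `τ = (π p  π q)` lies in `S_d ≀ S_n`, and `τ π v_λ = π (p q) v_λ =
-π v_λ` by (3.5), so symmetrising over `S_d ≀ S_n ∋ τ` gives `v_T = -v_T` (characteristic zero).
`-- DISCHARGEABLE` (proved here). [cite: BurgisserIkenmeyerPanovaJAMS2019, Lemma 4.3 (1)] -/
theorem tabVector_eq_zero_of_blockIdx_eq (hN : ∀ x ∈ Y.cells, x.1 < N)
    (T₀ : StdFilling (D * m) Y) (π : Equiv.Perm (Fin (D * m))) {p q : Fin (D * m)} (hpq : p ≠ q)
    (hcol : (T₀.1 p).2 = (T₀.1 q).2) (hblk : blockIdx D m (π p) = blockIdx D m (π q)) :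
    tabVector k hN T₀ π = 0 := by
  set S := tabVector k hN T₀ π with hS
  have hτ : Equiv.swap (π p) (π q) ∈ blockPerms D m := swap_mem_blockPerms hblk
  have hconj : Equiv.swap (π p) (π q) * π = π * Equiv.swap p q :=
    (Equiv.mul_swap_eq_swap_mul π p q).symm
  have hneg : S = -S := by
    have h1 : blockSymmetrizer k D m (wordPerm k (Equiv.swap (π p) (π q))
        (wordPerm k π (T₀.polytabloid k hN))) = S := by
      rw [hS, tabVector]
      exact blockSymmetrizer_wordPerm k hτ _
    have h2 : wordPerm k (Equiv.swap (π p) (π q)) (wordPerm k π (T₀.polytabloid k hN)) =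
        -wordPerm k π (T₀.polytabloid k hN) := by
      rw [← LinearMap.comp_apply, ← wordPerm_mul, hconj, wordPerm_mul, LinearMap.comp_apply,
        T₀.wordPerm_polytabloid_of_mem_colStab hN (StdFilling.swap_mem_colStab hcol),
        Equiv.Perm.sign_swap hpq, map_smul, Units.val_neg, Units.val_one, Int.cast_neg,
        Int.cast_one, neg_one_smul]
    conv_lhs => rw [← h1, h2, map_neg]
    rw [hS, tabVector]
  have h2 : (2 : k) • S = 0 := by
    rw [two_smul]
    nth_rewrite 2 [hneg]
    rw [add_neg_cancel]
  exact (smul_eq_zero.1 h2).resolve_left two_ne_zero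

omit [CharZero k] in
/-- **BIP Lemma 4.3(2).** "Let `T` and `T'` be two tableaux of shape `λ` with content `d × n`
that can be obtained from each other by switching two columns that have the same length. Then
`v_T = v_{T'}`." [tex:1604.06431 L1292–1295; held arXiv v1 text `paper:arxiv-1604.06431` Lemma 12,
p0009.txt:L99–L101]. In the word model: if `κ` is a permutation of the entries of `T₀` preserving
rows and mapping columns to columns (the row-wise exchange of two columns of `T₀` of the same
length is such a `κ`), then the content tableau of `(T₀, π κ)` — cell `T₀ p` carries the letter
`blockIdx (π (κ p))`, i.e. the letter that `T = T_λ(π)` has in the cell `T₀ (κ p)`: the columns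
SWITCHED — has the same vector: `v_{T'} = Σ (πκ · e_{T₀}) = Σ (π · e_{T₀}) = v_T` by (3.6)
(`StdFilling.wordPerm_polytabloid_of_rowPreserving`). `-- DISCHARGEABLE` (proved here).
[cite: BurgisserIkenmeyerPanovaJAMS2019, Lemma 4.3 (2)] -/
theorem tabVector_mul_eq_of_rowPreserving (hN : ∀ x ∈ Y.cells, x.1 < N)
    (T₀ : StdFilling (D * m) Y) (π : Equiv.Perm (Fin (D * m))) {κ : Equiv.Perm (Fin (D * m))}
    (hrow : ∀ p, (T₀.1 (κ p)).1 = (T₀.1 p).1)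
    (hcol : ∀ p q, (T₀.1 (κ p)).2 = (T₀.1 (κ q)).2 ↔ (T₀.1 p).2 = (T₀.1 q).2) :
    tabVector k hN T₀ (π * κ) = tabVector k hN T₀ π := by
  rw [tabVector, tabVector, wordPerm_mul, LinearMap.comp_apply,
    T₀.wordPerm_polytabloid_of_rowPreserving hN hrow hcol]

end Lemma43

/-! ### Prop. 4.5 as printed: `HWV_λ(Sym^d Sym^n V)` is spanned by the tableau vectors `v_T` -/

section Prop45

variable (k : Type*) [Field k] [CharZero k] {N D m : ℕ} {Y : YoungDiagram}

/-- **BIP Prop. 4.5, as printed.** "The vector space `HWV_λ(Sym^d Sym^n V)` is spanned by the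
highest weight vectors `v_T`, where `T` ranges over all equivalence classes of tableaux of shape
`λ` with content `d × n`, such that no letter appears more than once in a column of `T`."
[tex:1604.06431 L1338–1343; held arXiv v1 text `paper:arxiv-1604.06431` Proposition 14,
p0009.txt:L145–L149]. Here `V = k^N` (`k` of characteristic zero, `Y` the diagram of `λ ⊢ D·m`,
all of whose rows have index `< N`, i.e. `ℓ(λ) ≤ N`), `Sym^D Sym^m V ⊂ ⊗^{Dm} V` is the space of
`S_D ≀ S_m`-invariants of the word model ((4.1)), so `HWV_λ(Sym^D Sym^m V)` is
`Literature.RepresentationTheory.GeneralLinear.wreathHW k N 1 λ` (trivial character), and the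
`v_T` are the `tabVector k hN T₀ π` of a fixed standard filling `T₀` with `π` ranging over the
permutations whose content tableau `T_λ(π)` (cell `T₀ p ↦` letter `blockIdx D m (π p)`) has no
letter twice in a column. Def. 4.4's passage to EQUIVALENCE CLASSES (reordering singleton columns)
only removes duplicate generators (`v_T = v_{T'}` for `T ≃ T'`, Lemma 4.3(2)
`tabVector_mul_eq_of_rowPreserving`) and is not needed for a spanning statement. Proof (BIP §4(a)
verbatim): a wreath-invariant highest-weight vector `x` satisfies `|S_D ≀ S_m| · x = Σ x`
(`blockSymmetrizer_apply_of_forall_wordPerm_eq`); by Prop. 3.3 `x = ∑_T a_T e_T` over the standard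
tableaux, each `e_T = τ_T⁻¹ · e_{T₀}` (`StdFilling.polytabloid_eq_wordPerm`), so
`Σ x = ∑_T a_T v_{T_λ(τ_T⁻¹)}`, and the `v_T` with a repeated letter in a column vanish
(Lemma 4.3(1), `tabVector_eq_zero_of_blockIdx_eq`); conversely every `v_T` is a wreath-invariant
highest-weight vector of weight `λ` (`tabVector_mem_highestWeightSpace`, `wordPerm_tabVector`).
`-- DISCHARGEABLE` (proved here). [cite: BurgisserIkenmeyerPanovaJAMS2019, Prop. 4.5] -/
theorem wreathHW_one_eq_span_tabVector (hN : ∀ x ∈ Y.cells, x.1 < N) (hd : Y.cells.card = D * m)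
    (T₀ : StdFilling (D * m) Y) :
    Literature.RepresentationTheory.GeneralLinear.wreathHW k N (1 : ↥(blockPerms D m) →* ℤˣ)
        (ydWeight N Y) =
      Submodule.span k (tabVector k hN T₀ '' {π | ∀ p q : Fin (D * m), p ≠ q →
        (T₀.1 p).2 = (T₀.1 q).2 → blockIdx D m (π p) ≠ blockIdx D m (π q)}) := by
  classical
  apply le_antisymm
  · intro x hx
    rw [Literature.RepresentationTheory.GeneralLinear.mem_wreathHW_iff] at hx
    obtain ⟨hxw, hxinv⟩ := hx
    have hxinv' : ∀ τ ∈ blockPerms D m, wordPerm k τ x = x := fun τ hτ => by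
      have h := hxinv ⟨τ, hτ⟩
      rwa [MonoidHom.one_apply, Units.val_one, Int.cast_one, one_smul] at h
    -- `|S_D ≀ S_m| • x = Σ x`
    have hsym := blockSymmetrizer_apply_of_forall_wordPerm_eq k hxinv'
    -- `x = ∑_T a_T e_T` (Prop. 3.3, basis form)
    obtain ⟨a, ha⟩ := exists_sum_smul_polytabloid_eq hN hd hxw
    -- each `Σ e_T` is a tableau vector of `T₀`
    have hT : ∀ T : StdFilling (D * m) Y, ∃ τ : Equiv.Perm (Fin (D * m)),
        blockSymmetrizer k D m (T.polytabloid k hN) = tabVector k hN T₀ τ := by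
      intro T
      obtain ⟨τ, hτ⟩ := StdFilling.exists_perm_comp hd T T₀
      exact ⟨τ⁻¹, by rw [tabVector, StdFilling.polytabloid_eq_wordPerm hN τ hτ]⟩
    have hmem : blockSymmetrizer k D m x ∈ Submodule.span k (tabVector k hN T₀ ''
        {π | ∀ p q : Fin (D * m), p ≠ q → (T₀.1 p).2 = (T₀.1 q).2 →
          blockIdx D m (π p) ≠ blockIdx D m (π q)}) := by
      rw [← ha, map_sum]
      refine Submodule.sum_mem _ fun T _ => ?_
      rw [map_smul]
      refine Submodule.smul_mem _ _ ?_
      obtain ⟨τ, hτ⟩ := hT T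
      rw [hτ]
      by_cases hgood : ∀ p q : Fin (D * m), p ≠ q → (T₀.1 p).2 = (T₀.1 q).2 →
          blockIdx D m (τ p) ≠ blockIdx D m (τ q)
      · exact Submodule.subset_span ⟨τ, hgood, rfl⟩
      · simp only [not_forall, not_not] at hgood
        obtain ⟨p, q, hpq, hcol, hblk⟩ := hgood
        rw [tabVector_eq_zero_of_blockIdx_eq hN T₀ τ hpq hcol hblk]
        exact Submodule.zero_mem _
    rw [hsym] at hmem
    have hc : ((blockPermsFinset D m).card : k) ≠ 0 :=
      Nat.cast_ne_zero.mpr card_blockPermsFinset_pos.ne'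
    have h := Submodule.smul_mem _ (((blockPermsFinset D m).card : k)⁻¹) hmem
    rwa [← Nat.cast_smul_eq_nsmul k, smul_smul, inv_mul_cancel₀ hc, one_smul] at h
  · refine Submodule.span_le.mpr ?_
    rintro _ ⟨π, -, rfl⟩
    refine (Literature.RepresentationTheory.GeneralLinear.mem_wreathHW_iff _ _ _).mpr
      ⟨tabVector_mem_highestWeightSpace hN T₀ hd π, fun τ => ?_⟩
    rw [MonoidHom.one_apply, Units.val_one, Int.cast_one, one_smul]
    exact wordPerm_tabVector hN T₀ π τ.2

end Prop45

end Literature.Computability.AlgebraicComplexity
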